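import Summits.QuantumFields.YangMills.Theorems.LuscherReductionDressedRitzPolyakovLiftPScalingSlowStiff
import Summits.QuantumFields.YangMills.Theorems.LuscherReductionDressedRitzPolyakovLiftShadowPositivity
import HarnessLib

/-!
# Route `LuscherReduction`, item `DressedRitz` (stmt-QuantumFields-20205), line «polyakovlift» r5 — S-PSCAL from SPECTRAL BUDGETS:
# `ShadowBudgetAt k → PScalingExistsAt k` (the plumbing of lane W1-A, so that the lane proves eigenvector control and nothing else)

Support module (LEAD prover ym-lead-20205-polyakovlift g0; `--supports stmt-QuantumFields-20205`, helper).  `PScalingExistsAt k` (tree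
`…PolyakovLiftUniversalityExists.lean`) = (o0′) ∧ (o5′) ∧ (o6′) for the one-site shadow family `w = shadowFamily B L e₀ g`, `B = 2L³/Λ³`, of SOME lift basis
at `B₁ = 2/Λ³`.  This file isolates what the ONE-type semiclassics must deliver — `ShadowBudgetAt k`: for some lift basis, for each `i` an exact
`l2`-orthonormal eigenfamily of `K_B` with a pivot `κ_i` `e^{C₁Λ²/L}`-close to `μ_{i+1}(B)` and the SLOW/STIFF budget `≤ (1 − e^{−C₂Λ²/L})κ_i‖w_i‖²`, and for
each pair `i ≠ l` an eigenfamily whose COUPLING budget (the right-hand side of `LiftPos.coupling_defect_le` at `κ = ½(ρ_i + ρ_l)`) is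
`≤ C₃(Λ²/L)μ₀√(‖w_i‖²‖w_l‖²)` — and proves

* ★ `pscalingExistsAt_of_shadowBudget : ShadowBudgetAt k → PScalingExistsAt k` (constant `max (C₁ + C₂) C₃`; (o0′) from the tree's `shadowFamily_o0`
  for every lift basis, `L0` raised to `≥ 1`; (o5′) by `pscalO5_of_slow_stiff`; (o6′) by `LiftPos.coupling_defect_le`).

HONEST FRAMING: Rayleigh-quotient plumbing on the one-site lattice (conditional femto rung R2b1); `ShadowBudgetAt` — eigenvector control of the shadow
insertions `ins_{e₀}(g_i ∘ powLink L)` in the `B`-model, ONE-type semiclassics in two couplings (`PSCAL-LEADING-ORDER.md`, `WAVE-1-BRIEFS.md` W1-A) — is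
OPEN; nothing here bears on infinite volume, the continuum limit or the Clay gap.  References: M. Lüscher, NPB 219 (1983) 233 [cite: Luscher1983, §3];
T. Kato (1966) §V.4 [cite: Kato1966, §V.4].
-/

set_option autoImplicit false

noncomputable section

open MeasureTheory Filter Topology Real
open Literature.MathematicalPhysics.QuantumFieldTheory (GaugeConfig Site gaugeTransform)
open scoped BigOperators

namespace Summit.QuantumFields.YangMills.Theorems.FemtoTransferGap.PolyakovLift

open Summit.QuantumFields.YangMills.Theorems.FemtoTransferGap
open Summit.QuantumFields.YangMills.Theorems.FemtoTransferGap.LiftPos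

/-- **`ShadowBudgetAt k`** — what lane W1-A must prove: in the S-PSCAL quantifier frame (`Λ ∈ [lam, 2lam]`, `lam ≤ lam0`, `L ≥ L0`, raw vacuum `e₀` of the
`B = 2L³/Λ³` model) there is a lift basis `(ω, g)` at `B₁ = 2/Λ³` whose shadow vectors `w_i = shadowFamily B L e₀ g i` admit (i) for each `i` an exact
`l2`-orthonormal eigenfamily `ψ` of `K_B`, a pivot `κ ∈ [0, μ₀]` with `κ ≤ e^{C₁Λ²/L}μ_{i+1}`, `μ_{i+1} ≤ e^{C₁Λ²/L}κ`, and slow/stiff budget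
`Σ_j|ev_j − κ|⟨w_i,ψ_j⟩² + μ₀‖w_i − Σ_j⟨w_i,ψ_j⟩ψ_j‖² ≤ (1 − e^{−C₂Λ²/L})κ‖w_i‖²`; (ii) for each `i ≠ l` an exact eigenfamily whose coupling budget at
`κ = ½(ρ_i + ρ_l)` is `≤ C₃(Λ²/L)μ₀√‖w_i‖²√‖w_l‖²`. [cite: Luscher1983, §3] -/
def ShadowBudgetAt (k : ℕ) : Prop :=
  ∃ C₁ C₂ C₃ lam0 : ℝ, 0 ≤ C₁ ∧ 0 ≤ C₂ ∧ 0 ≤ C₃ ∧ 0 < lam0 ∧ ∀ lam : ℝ, 0 < lam → lam ≤ lam0 → ∃ L0 : ℕ, ∀ L : ℕ, L0 ≤ L →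
    ∀ Λ : ℝ, lam ≤ Λ → Λ ≤ 2 * lam →
      ∀ e₀ : GaugeConfig 3 1 SU2 → ℝ, IsRawVacuum (L := 1) (2 * (L : ℝ) ^ 3 / Λ ^ 3) e₀ →
        ∃ (ω : GaugeConfig 3 1 SU2 → ℝ) (g : Fin k → (GaugeConfig 3 1 SU2 → ℝ)), LiftBasis (2 / Λ ^ 3) k ω g ∧
          let B : ℝ := 2 * (L : ℝ) ^ 3 / Λ ^ 3
          let w : Fin k → (GaugeConfig 3 1 SU2 → ℝ) := shadowFamily B L e₀ g
          let m0 := levelValue su2Rep 1 B 0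
          (∀ i : Fin k, ∃ (N : ℕ) (ψ : Fin N → (GaugeConfig 3 1 SU2 → ℝ)) (ev : Fin N → ℝ) (κ : ℝ),
            (∀ j, IsPhys (ψ j)) ∧ (∀ j l, l2 (ψ j) (ψ l) = if j = l then 1 else 0) ∧
            (∀ j, transferApply B (ψ j) = ev j • ψ j) ∧ 0 ≤ κ ∧ κ ≤ m0 ∧
            κ ≤ Real.exp (C₁ * Λ ^ 2 / L) * levelValue su2Rep 1 B ((i : ℕ) + 1) ∧
            levelValue su2Rep 1 B ((i : ℕ) + 1) ≤ Real.exp (C₁ * Λ ^ 2 / L) * κ ∧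
            ∑ j, |ev j - κ| * l2 (w i) (ψ j) ^ 2 + m0 * l2 (w i - ∑ j, l2 (w i) (ψ j) • ψ j) (w i - ∑ j, l2 (w i) (ψ j) • ψ j) ≤
              (1 - Real.exp (-(C₂ * Λ ^ 2 / L))) * (κ * l2 (w i) (w i))) ∧
          (∀ i l : Fin k, i ≠ l → ∃ (N : ℕ) (ψ : Fin N → (GaugeConfig 3 1 SU2 → ℝ)) (ev : Fin N → ℝ),
            (∀ j, IsPhys (ψ j)) ∧ (∀ j j', l2 (ψ j) (ψ j') = if j = j' then 1 else 0) ∧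
            (∀ j, transferApply B (ψ j) = ev j • ψ j) ∧
            let κ : ℝ := (l2 (w i) (transferApply B (w i)) / l2 (w i) (w i) + l2 (w l) (transferApply B (w l)) / l2 (w l) (w l)) / 2
            ∑ j, |ev j - κ| * |l2 (w i) (ψ j) * l2 (w l) (ψ j)| +
                (m0 + |κ|) *
                  (Real.sqrt (l2 (w i - ∑ j, l2 (w i) (ψ j) • ψ j) (w i - ∑ j, l2 (w i) (ψ j) • ψ j)) *
                    Real.sqrt (l2 (w l - ∑ j, l2 (w l) (ψ j) • ψ j) (w l - ∑ j, l2 (w l) (ψ j) • ψ j))) ≤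
              C₃ * (Λ ^ 2 / L) * m0 * (Real.sqrt (l2 (w i) (w i)) * Real.sqrt (l2 (w l) (w l))))

/-- ★★ **`ShadowBudgetAt k → PScalingExistsAt k`** (constant `max (C₁ + C₂) C₃`; `L0` raised to `≥ 1`). [cite: Luscher1983, §3] -/
theorem pscalingExistsAt_of_shadowBudget {k : ℕ} (h : ShadowBudgetAt k) : PScalingExistsAt k := by
  obtain ⟨C₁, C₂, C₃, lam0, hC₁, hC₂, hC₃, hlam0, hk⟩ := h
  refine ⟨max (C₁ + C₂) C₃, lam0, hC₃.trans (le_max_right _ _), hlam0, fun lam hlam hle => ?_⟩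
  obtain ⟨L0, hL⟩ := hk lam hlam hle
  refine ⟨max L0 1, fun L hL0 Λ hlo hhi e₀ he₀ => ?_⟩
  obtain ⟨ω, g, hbasis, h5, h6⟩ := hL L ((le_max_left _ _).trans hL0) Λ hlo hhi e₀ he₀
  have hLpos : 0 < L := lt_of_lt_of_le zero_lt_one ((le_max_right _ _).trans hL0)
  have hLr : (0 : ℝ) < L := Nat.cast_pos.mpr hLpos
  have hΛ : 0 < Λ := hlam.trans_le hlo
  have hBpos : 0 < 2 * (L : ℝ) ^ 3 / Λ ^ 3 := div_pos (mul_pos two_pos (pow_pos hLr 3)) (pow_pos hΛ 3)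
  have hB1pos : 0 < 2 / Λ ^ 3 := div_pos two_pos (pow_pos hΛ 3)
  set B : ℝ := 2 * (L : ℝ) ^ 3 / Λ ^ 3 with hBdef
  set w : Fin k → (GaugeConfig 3 1 SU2 → ℝ) := shadowFamily B L e₀ g with hwdef
  set m0 := levelValue su2Rep 1 B 0 with hm0
  have hm0pos : 0 < m0 := levelValue_su2Rep_pos (L := 1) hBpos 0
  have hg : ∀ i, IsPhys (g i) := hbasis.2.2.2.2.1
  have hw : ∀ i, IsPhys (w i) := fun i => by
    simp only [hwdef, shadowFamily, shadowVec]
    exact isPhys_iterate_transferApply B (OpPlat.isPhys_ins he₀.1 (isPhys_comp_powLink L (hg i))) _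
  have htL : 0 ≤ Λ ^ 2 / (L : ℝ) := div_nonneg (sq_nonneg _) hLr.le
  have hexp_mono : Real.exp ((C₁ + C₂) * Λ ^ 2 / L) ≤ Real.exp (max (C₁ + C₂) C₃ * Λ ^ 2 / L) := by
    apply Real.exp_le_exp.mpr
    rw [mul_div_assoc, mul_div_assoc]
    exact mul_le_mul_of_nonneg_right (le_max_left _ _) htL
  refine ⟨ω, g, hbasis, ?_, ?_, ?_⟩
  · -- (o0′) for every lift basis (tree)
    exact shadowFamily_o0 hBpos hB1pos hLpos he₀ hbasis
  · -- (o5′) by the slow/stiff pinch, then monotonicity of the tolerance in the constant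
    intro i
    have hp := pscalO5_of_slow_stiff (k := k) C₁ C₂ (L := L) (Λ := Λ) hBpos.le hw h5 i
    obtain ⟨hp1, hp2⟩ := hp
    have hn0 : 0 ≤ l2 (w i) (w i) := l2_self_nonneg _
    have hd0 : 0 ≤ l2 (w i) (transferApply B (w i)) * m0 := by
      rw [← qform_eq_l2_transferApply]; exact mul_nonneg (qform_su2Rep_self_nonneg hBpos.le (hw i)) hm0pos.le
    have hμ1 : 0 ≤ levelValue su2Rep 1 B ((i : ℕ) + 1) * m0 := mul_nonneg (levelValue_su2Rep_nonneg 1 hBpos.le _) hm0pos.le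
    constructor
    · exact hp1.trans (mul_le_mul_of_nonneg_right (mul_le_mul_of_nonneg_right hexp_mono hμ1) hn0)
    · exact hp2.trans (mul_le_mul_of_nonneg_right hexp_mono hd0)
  · -- (o6′) by the generic coupling-defect bound, then `C₃ ≤ max`
    intro i l hil
    obtain ⟨N, ψ, ev, hψ, hon, heig, hbud⟩ := h6 i l hil
    have hcd := coupling_defect_le (L := 1) hBpos.le hψ hon ev heig (hw i) (hw l)
      ((l2 (w i) (transferApply B (w i)) / l2 (w i) (w i) + l2 (w l) (transferApply B (w l)) / l2 (w l) (w l)) / 2)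
    refine (hcd.trans hbud).trans ?_
    have hs : 0 ≤ Real.sqrt (l2 (w i) (w i)) * Real.sqrt (l2 (w l) (w l)) := mul_nonneg (Real.sqrt_nonneg _) (Real.sqrt_nonneg _)
    have : C₃ * (Λ ^ 2 / L) * m0 ≤ max (C₁ + C₂) C₃ * (Λ ^ 2 / L) * m0 :=
      mul_le_mul_of_nonneg_right (mul_le_mul_of_nonneg_right (le_max_right _ _) htL) hm0pos.le
    exact mul_le_mul_of_nonneg_right this hs

end Summit.QuantumFields.YangMills.Theorems.FemtoTransferGap.PolyakovLift

end
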